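import Literature.RingTheory.MvPowerSeries.ConvergentPowerSeries
import Mathlib.Analysis.Analytic.Basic
import Mathlib.Algebra.Order.Antidiag.Finsupp
import Mathlib.Algebra.BigOperators.Pi
import Mathlib.Data.Finsupp.Weight
import HarnessLib

/-!
# Analytic functions of finitely many variables are locally sums of convergent power series

Topic `Literature/RingTheory/MvPowerSeries`.  The bridge between Mathlib's notion of analyticity
(`HasFPowerSeriesOnBall f p x r`: `f (x + y) = ∑ₖ pₖ(y, …, y)` with `p` a formal MULTILINEAR
series on the normed space `ι → 𝕜`, sup norm) and the convergent power series of this directory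
(`MvPowerSeries ι 𝕜` with the weighted `ℓ¹`-norms `wnorm` and the evaluation `eval` of
`ConvergentPowerSeries.lean`; H. Grauert, R. Remmert, *Analytische Stellenalgebren* (1971),
Kap. I §§1–3): **if `f` has a power series expansion on a ball around `x`, then there is a power
series `P = ∑_α c_α X^α` with `‖P‖_ρ < ∞` for some `ρ > 0` and `f (x + y) = P(y)` on the closed
polydisc `‖yᵢ‖ ≤ ρ`** (`exists_wnorm_lt_top_eval_eq_of_hasFPowerSeriesOnBall`), and the
compactness corollary: a function analytic on a neighbourhood of a compact set `K ⊆ 𝕜^ι` is, on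
each member of a finite cover of `K` by open polydiscs, the sum of a convergent power series
centred there (`exists_finset_cover_eval_eq_of_analyticOnNhd`).  This is the (folklore) first
step in reading a "restricted analytic function" in the sense of real-analytic geometry
(analytic on a neighbourhood of a cube; `Literature/ModelTheory/ExponentialFields/RealAnExp.lean`)
as finitely many convergent power series, the primitives of the Denef–van den Dries language of
`ℝ_an` (`RealAnTerms.lean`).

## The proof

Expanding `y = ∑ᵢ yᵢ eᵢ` multilinearly, `pₖ(y, …, y) = ∑_{τ : Fin k → ι} (∏ₗ y_{τ l}) pₖ(e_{τ 0}, …)`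
(as in `Literature.AlgebraicGeometry.Motives.exists_mvPolynomial_eval_eq_apply_diag`), i.e.
`pₖ(y, …, y)` is the value at `y` of the homogeneous polynomial
`Qₖ = ∑_τ pₖ(e_τ) X^{cnt τ}` of degree `k` (`eval_diagPoly`), whose coefficients have total size
`≤ (#ι)ᵏ ‖pₖ‖` (`wnorm_diagPoly_le`).  The power series `P = ∑ₖ Qₖ` (a coefficientwise finite sum)
therefore has `‖P‖_ρ ≤ ∑ₖ ‖pₖ‖ (#ι · ρ)ᵏ < ∞` as soon as `#ι · ρ` is smaller than the radius of
`p`, and on the polydisc its sum, regrouped by degrees (`HasSum.sigma`), is `∑ₖ pₖ(y, …, y)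
= f (x + y)`.

Everything is proved; no definitions besides local abbreviations in statements; no named facts.

## References

* [GrauertRemmert1971] H. Grauert, R. Remmert, *Analytische Stellenalgebren*, Springer (1971),
  Kap. I §§1–3 (convergent power series, the algebras `B_ρ`).
* [Ruiz1993] J. M. Ruiz, *The basic theory of power series*, Vieweg (1993), §§1–3.
-/

noncomputable section

open MvPowerSeries Finsupp Filter
open scoped NNReal ENNReal Topology BigOperators

namespace Literature.RingTheory.MvPowerSeries

variable {ι : Type*} [Fintype ι] [DecidableEq ι] {𝕜 : Type*} [NontriviallyNormedField 𝕜]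

/-! ### Weights and monomials at a constant polyradius; count vectors -/

omit [Fintype ι] [DecidableEq ι] in
/-- At a constant polyradius the weight of `X^α` is `ρ ^ |α|`. [folklore] -/
theorem wt_const (ρ : ℝ≥0) (α : ι →₀ ℕ) : wt (fun _ : ι => ρ) α = ρ ^ α.degree := by
  rw [wt_eq_prod, Finset.prod_pow_eq_pow_sum, Finsupp.degree_apply]

omit [Fintype ι] [DecidableEq ι] in
/-- The count vector `cnt τ = ∑ₗ e_{τ l}` of a word `τ : Fin k → ι` has degree `k`. [folklore] -/
theorem degree_sum_single {k : ℕ} (τ : Fin k → ι) :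
    (∑ l, Finsupp.single (τ l) (1 : ℕ)).degree = k := by
  rw [map_sum]
  simp

omit [Fintype ι] [DecidableEq ι] in
/-- The monomial of a count vector is the corresponding product of coordinates:
`y^{cnt τ} = ∏ₗ y_{τ l}`. [folklore] -/
theorem mono_sum_single {k : ℕ} (y : ι → 𝕜) (τ : Fin k → ι) (s : Finset (Fin k)) :
    mono y (∑ l ∈ s, Finsupp.single (τ l) (1 : ℕ)) = ∏ l ∈ s, y (τ l) := by
  classical
  induction s using Finset.induction_on with
  | empty => simp
  | insert a s ha ih =>
    rw [Finset.sum_insert ha, Finset.prod_insert ha, mono_add, ih, mono_single, pow_one]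

/-! ### The homogeneous polynomials of a multilinear series -/

/-- **Diagonals of continuous multilinear forms are homogeneous polynomials**: for a continuous
`k`-linear form `A` on `ι → 𝕜`, the polynomial `∑_{τ : Fin k → ι} A(e_{τ 0}, …, e_{τ (k-1)}) X^{cnt τ}`
evaluates at `y` to `A (y, …, y)` (expand `y = ∑ᵢ yᵢ eᵢ` multilinearly). [folklore] -/
theorem eval_diagPoly {k : ℕ} (A : ContinuousMultilinearMap 𝕜 (fun _ : Fin k => ι → 𝕜) 𝕜)
    (y : ι → 𝕜) :
    MvPolynomial.eval y (∑ τ : Fin k → ι, MvPolynomial.monomial (∑ l, Finsupp.single (τ l) 1)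
      (A fun l => Pi.single (τ l) 1)) = A fun _ => y := by
  have hy : (fun _ : Fin k => y) = fun _ => ∑ i, y i • (Pi.single i (1 : 𝕜) : ι → 𝕜) := by
    funext l
    exact pi_eq_sum_univ' y
  rw [hy, A.map_sum fun _ i => y i • (Pi.single i (1 : 𝕜) : ι → 𝕜), map_sum]
  refine Finset.sum_congr rfl fun τ _ => ?_
  rw [MvPolynomial.eval_monomial, A.map_smul_univ (fun l => y (τ l))
    fun l => (Pi.single (τ l) (1 : 𝕜) : ι → 𝕜), smul_eq_mul, mul_comm]
  congr 1
  exact mono_sum_single y τ Finset.univ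

/-- The coefficients of the diagonal polynomial vanish off degree `k` (it is homogeneous of
degree `k`). [folklore] -/
theorem coeff_diagPoly_eq_zero {k : ℕ} (A : ContinuousMultilinearMap 𝕜 (fun _ : Fin k => ι → 𝕜) 𝕜)
    {α : ι →₀ ℕ} (hα : α.degree ≠ k) :
    MvPolynomial.coeff α (∑ τ : Fin k → ι, MvPolynomial.monomial (∑ l, Finsupp.single (τ l) 1)
      (A fun l => Pi.single (τ l) 1)) = 0 := by
  rw [MvPolynomial.coeff_sum]
  refine Finset.sum_eq_zero fun τ _ => ?_
  rw [MvPolynomial.coeff_monomial, if_neg]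
  intro h
  apply hα
  rw [← h, degree_sum_single]

/-- **Coefficient bound for the diagonal polynomial**: as a power series,
`‖∑_τ A(e_τ) X^{cnt τ}‖_ρ ≤ (#ι)ᵏ ‖A‖ ρᵏ` at the constant polyradius `ρ` (each of the `(#ι)ᵏ`
coefficients has norm `≤ ‖A‖ ∏ₗ ‖e_{τ l}‖ = ‖A‖`). [folklore] -/
theorem wnorm_diagPoly_le {k : ℕ} (A : ContinuousMultilinearMap 𝕜 (fun _ : Fin k => ι → 𝕜) 𝕜)
    (ρ : ℝ≥0) :
    wnorm (fun _ : ι => ρ) ((∑ τ : Fin k → ι, MvPolynomial.monomial (∑ l, Finsupp.single (τ l) 1)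
      (A fun l => Pi.single (τ l) 1) : MvPolynomial ι 𝕜) : MvPowerSeries ι 𝕜) ≤
      (((Fintype.card ι) ^ k * ‖A‖₊ * ρ ^ k : ℝ≥0) : ℝ≥0∞) := by
  rw [← MvPolynomial.coeToMvPowerSeries.ringHom_apply, map_sum]
  refine (wnorm_sum_le _ _ _).trans ?_
  have hterm : ∀ τ : Fin k → ι,
      wnorm (fun _ : ι => ρ) (MvPolynomial.coeToMvPowerSeries.ringHom
        (MvPolynomial.monomial (∑ l, Finsupp.single (τ l) 1) (A fun l => Pi.single (τ l) 1))) ≤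
        ((‖A‖₊ * ρ ^ k : ℝ≥0) : ℝ≥0∞) := by
    intro τ
    rw [MvPolynomial.coeToMvPowerSeries.ringHom_apply, MvPolynomial.coe_monomial, wnorm_monomial,
      wt_const, degree_sum_single, ENNReal.coe_le_coe]
    refine mul_le_mul_of_nonneg_right ?_ zero_le
    refine (A.le_opNNNorm _).trans ?_
    have h1 : ∏ l : Fin k, ‖(Pi.single (τ l) (1 : 𝕜) : ι → 𝕜)‖₊ = 1 :=
      Finset.prod_eq_one fun l _ => by rw [Pi.nnnorm_single, nnnorm_one]
    rw [h1, mul_one]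
  refine (Finset.sum_le_sum fun τ _ => hterm τ).trans ?_
  rw [Finset.sum_const, Finset.card_univ, Fintype.card_fun, Fintype.card_fin, nsmul_eq_mul]
  push_cast
  rw [mul_assoc]

/-! ### From a multilinear power series to a convergent power series -/

section Complete

variable [CompleteSpace 𝕜]

open MvPowerSeries.WithPiTopology in
/-- **A function with a power series expansion on a ball is, near the centre, the sum of a
convergent power series in the coordinates**: if `HasFPowerSeriesOnBall f p x r` on `ι → 𝕜`
(`ι` finite), there are a power series `P ∈ 𝕜⟦Xᵢ : i ∈ ι⟧` and `ρ > 0`, `ρ < r`, with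
`‖P‖_ρ < ∞` and `P(y) = f (x + y)` whenever `‖yᵢ‖ ≤ ρ` for all `i` (Grauert–Remmert 1971,
Kap. I §3: holomorphic = locally a convergent power series; here derived from Mathlib's
multilinear expansions). [folklore] -/
theorem exists_wnorm_lt_top_eval_eq_of_hasFPowerSeriesOnBall {f : (ι → 𝕜) → 𝕜}
    {p : FormalMultilinearSeries 𝕜 (ι → 𝕜) 𝕜} {x : ι → 𝕜} {r : ℝ≥0∞}
    (hf : HasFPowerSeriesOnBall f p x r) :
    ∃ (P : MvPowerSeries ι 𝕜) (ρ : ℝ≥0), 0 < ρ ∧ (ρ : ℝ≥0∞) < r ∧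
      wnorm (fun _ : ι => ρ) P < ⊤ ∧
      ∀ y : ι → 𝕜, (∀ i, ‖y i‖₊ ≤ ρ) → eval P y = f (x + y) := by
  classical
  -- the homogeneous pieces
  set Q : ℕ → MvPolynomial ι 𝕜 := fun k => ∑ τ : Fin k → ι,
    MvPolynomial.monomial (∑ l, Finsupp.single (τ l) 1) (p k fun l => Pi.single (τ l) 1) with hQ
  have hQcoeff : ∀ (k : ℕ) (α : ι →₀ ℕ), α.degree ≠ k → MvPolynomial.coeff α (Q k) = 0 :=
    fun k α h => coeff_diagPoly_eq_zero (p k) h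
  have hQeval : ∀ (k : ℕ) (y : ι → 𝕜), MvPolynomial.eval y (Q k) = p k fun _ => y :=
    fun k y => eval_diagPoly (p k) y
  have hQwnorm : ∀ (k : ℕ) (ρ : ℝ≥0), wnorm (fun _ : ι => ρ) (Q k : MvPowerSeries ι 𝕜) ≤
      (((Fintype.card ι) ^ k * ‖p k‖₊ * ρ ^ k : ℝ≥0) : ℝ≥0∞) :=
    fun k ρ => wnorm_diagPoly_le (p k) ρ
  -- a radius: `0 < r' < r`, `ρ = r' / (#ι + 1)`, so that `#ι ρ ≤ r'` and `ρ ≤ r'`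
  obtain ⟨r', hr'0, hr'r⟩ := ENNReal.lt_iff_exists_nnreal_btwn.1 hf.r_pos
  have hr'0' : 0 < r' := by exact_mod_cast hr'0
  set ρ : ℝ≥0 := r' / (Fintype.card ι + 1) with hρ
  have hρpos : 0 < ρ := div_pos hr'0' (by positivity)
  have hρle : ρ ≤ r' := div_le_self zero_le (by simp)
  have hnρ : (Fintype.card ι : ℝ≥0) * ρ ≤ r' := by
    have h1 : ((Fintype.card ι : ℝ≥0) / (Fintype.card ι + 1)) ≤ 1 :=
      div_le_one_of_le₀ le_self_add zero_le
    calc (Fintype.card ι : ℝ≥0) * ρ = r' * ((Fintype.card ι : ℝ≥0) / (Fintype.card ι + 1)) := by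
          rw [hρ]; ring
      _ ≤ r' * 1 := mul_le_mul_of_nonneg_left h1 zero_le
      _ = r' := mul_one _
  have hr'rad : (r' : ℝ≥0∞) < p.radius := lt_of_lt_of_le hr'r hf.r_le
  have hnρrad : (((Fintype.card ι : ℝ≥0) * ρ : ℝ≥0) : ℝ≥0∞) < p.radius :=
    lt_of_le_of_lt (by exact_mod_cast hnρ) hr'rad
  -- the power series: coefficientwise (finite) sum of the `Q k`
  have hcoeffQ : ∀ (α : ι →₀ ℕ) (k : ℕ), k ≠ α.degree →
      MvPowerSeries.coeff α (Q k : MvPowerSeries ι 𝕜) = 0 := by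
    intro α k hk
    rw [MvPolynomial.coeff_coe]
    exact hQcoeff k α (Ne.symm hk)
  have hsum : Summable fun k => (Q k : MvPowerSeries ι 𝕜) := by
    rw [summable_iff_summable_coeff]
    intro α
    exact summable_of_ne_finset_zero (s := {α.degree}) fun k hk =>
      hcoeffQ α k (by simpa using hk)
  set P : MvPowerSeries ι 𝕜 := ∑' k, (Q k : MvPowerSeries ι 𝕜) with hP
  have hPcoeff : ∀ α : ι →₀ ℕ,
      MvPowerSeries.coeff α P = MvPolynomial.coeff α (Q α.degree) := by
    intro α
    have h := (hasSum_iff_hasSum_coeff.1 hsum.hasSum) α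
    rw [hP, ← h.tsum_eq, tsum_eq_single α.degree fun k hk => hcoeffQ α k hk,
      MvPolynomial.coeff_coe]
  -- the norm bound
  have hwn : wnorm (fun _ : ι => ρ) P < ⊤ := by
    refine lt_of_le_of_lt ((wnorm_tsum_le _ hsum).trans (ENNReal.tsum_le_tsum fun k =>
      hQwnorm k ρ)) ?_
    have hs : Summable fun k : ℕ => ‖p k‖₊ * ((Fintype.card ι : ℝ≥0) * ρ) ^ k :=
      p.summable_nnnorm_mul_pow hnρrad
    have heq : (fun k : ℕ => (((Fintype.card ι) ^ k * ‖p k‖₊ * ρ ^ k : ℝ≥0) : ℝ≥0∞)) =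
        fun k => ((‖p k‖₊ * ((Fintype.card ι : ℝ≥0) * ρ) ^ k : ℝ≥0) : ℝ≥0∞) := by
      funext k
      congr 1
      rw [mul_pow]
      ring
    rw [heq, lt_top_iff_ne_top, ENNReal.tsum_coe_ne_top_iff_summable]
    exact hs
  refine ⟨P, ρ, hρpos, lt_of_le_of_lt (by exact_mod_cast hρle) hr'r, hwn, fun y hy => ?_⟩
  -- the evaluation: regroup `∑_α c_α y^α` by degrees
  have hyr : y ∈ Metric.eball (0 : ι → 𝕜) r := by
    rw [mem_eball_zero_iff, enorm_eq_nnnorm]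
    exact lt_of_le_of_lt (ENNReal.coe_le_coe.2 (pi_nnnorm_le_iff.2 hy))
      (lt_of_le_of_lt (ENNReal.coe_le_coe.2 hρle) hr'r)
  have hf' : HasSum (fun k => p k fun _ => y) (f (x + y)) := hf.hasSum hyr
  have hev : HasSum (fun α => MvPowerSeries.coeff α P * mono y α) (eval P y) := hasSum_eval hy hwn
  -- degree fibres
  set S : ℕ → Finset (ι →₀ ℕ) := fun k => (Finset.univ : Finset ι).finsuppAntidiag k with hS
  have hmemS : ∀ (k : ℕ) (α : ι →₀ ℕ), α ∈ S k ↔ α.degree = k := by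
    intro k α
    simp [hS, Finset.mem_finsuppAntidiag, Finsupp.degree_eq_sum]
  let e : (Σ k : ℕ, ↥(S k)) ≃ (ι →₀ ℕ) :=
    { toFun := fun q => (q.2 : ι →₀ ℕ)
      invFun := fun α => ⟨α.degree, ⟨α, (hmemS _ α).2 rfl⟩⟩
      left_inv := by
        rintro ⟨k, α, hα⟩
        obtain rfl : α.degree = k := (hmemS k α).1 hα
        rfl
      right_inv := fun α => rfl }
  have hev' : HasSum ((fun α => MvPowerSeries.coeff α P * mono y α) ∘ e) (eval P y) :=
    (e.hasSum_iff).2 hev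
  have hfib : ∀ k : ℕ, HasSum (fun c : ↥(S k) =>
      ((fun α => MvPowerSeries.coeff α P * mono y α) ∘ e) ⟨k, c⟩) (p k fun _ => y) := by
    intro k
    have hfin := hasSum_fintype fun c : ↥(S k) =>
      ((fun α => MvPowerSeries.coeff α P * mono y α) ∘ e) ⟨k, c⟩
    have hval : ∑ c : ↥(S k), ((fun α => MvPowerSeries.coeff α P * mono y α) ∘ e) ⟨k, c⟩ =
        p k fun _ => y := by
      rw [← hQeval k y]
      change ∑ c : ↥(S k), MvPowerSeries.coeff (c : ι →₀ ℕ) P * mono y c = _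
      rw [Finset.sum_coe_sort (S k) fun α => MvPowerSeries.coeff α P * mono y α,
        MvPolynomial.eval_eq]
      -- both sides are sums over the degree-`k` vectors of `coeff α (Q k) * y^α`
      have h1 : ∑ α ∈ S k, MvPowerSeries.coeff α P * mono y α =
          ∑ α ∈ S k, MvPolynomial.coeff α (Q k) * mono y α := by
        refine Finset.sum_congr rfl fun α hα => ?_
        rw [hPcoeff, (hmemS k α).1 hα]
      rw [h1]
      symm
      refine Finset.sum_subset (fun α hα => ?_) (fun α _ hα => ?_)
      · -- the support of `Q k` lies in degree `k`
        rw [hmemS]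
        by_contra hne
        exact (MvPolynomial.mem_support_iff.1 hα) (hQcoeff k α hne)
      · rw [MvPolynomial.notMem_support_iff.1 hα, zero_mul]
    rwa [hval] at hfin
  exact (hev'.sigma hfib).unique hf'

/-- **Analytic functions on a neighbourhood of a compact set are, locally and uniformly, sums of
convergent power series**: if `f` is analytic on a set `U ⊇ K` (at every point of `U`), `K` compact,
there are finitely many centres `x ∈ K` with radii `ρₓ > 0` and power series `Pₓ`, `‖Pₓ‖_{ρₓ} < ∞`,
such that the open polydiscs `{y | ‖yᵢ - xᵢ‖ < ρₓ}` cover `K` and `f y = Pₓ(y - x)` on the closed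
polydisc `‖yᵢ - xᵢ‖ ≤ ρₓ`. [folklore] -/
theorem exists_finset_cover_eval_eq_of_analyticOnNhd {f : (ι → 𝕜) → 𝕜} {U K : Set (ι → 𝕜)}
    (hf : AnalyticOnNhd 𝕜 f U) (hK : IsCompact K) (hKU : K ⊆ U) :
    ∃ (s : Finset (ι → 𝕜)) (ρ : (ι → 𝕜) → ℝ≥0) (P : (ι → 𝕜) → MvPowerSeries ι 𝕜),
      (↑s ⊆ K) ∧
      (∀ x ∈ s, 0 < ρ x ∧ wnorm (fun _ : ι => ρ x) (P x) < ⊤ ∧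
        ∀ y : ι → 𝕜, (∀ i, ‖y i - x i‖₊ ≤ ρ x) → eval (P x) (y - x) = f y) ∧
      K ⊆ ⋃ x ∈ s, {y : ι → 𝕜 | ∀ i, ‖y i - x i‖₊ < ρ x} := by
  classical
  have hloc : ∀ x ∈ K, ∃ (P : MvPowerSeries ι 𝕜) (ρ : ℝ≥0), 0 < ρ ∧
      wnorm (fun _ : ι => ρ) P < ⊤ ∧
      ∀ y : ι → 𝕜, (∀ i, ‖y i - x i‖₊ ≤ ρ) → eval P (y - x) = f y := by
    intro x hx
    obtain ⟨p, r, hp⟩ := hf x (hKU hx)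
    obtain ⟨P, ρ, hρ, -, hw, hev⟩ := exists_wnorm_lt_top_eval_eq_of_hasFPowerSeriesOnBall hp
    refine ⟨P, ρ, hρ, hw, fun y hy => ?_⟩
    rw [hev (y - x) (by simpa using hy), add_sub_cancel]
  choose! P ρ hρ hw hev using hloc
  -- the open polydiscs cover `K`
  have hopen : ∀ x, IsOpen {y : ι → 𝕜 | ∀ i, ‖y i - x i‖₊ < ρ x} := by
    intro x
    simp only [Set.setOf_forall]
    exact isOpen_iInter_of_finite fun i =>
      isOpen_lt (continuous_nnnorm.comp ((continuous_apply i).sub continuous_const)) continuous_const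
  have hcover : K ⊆ ⋃ x ∈ K, {y : ι → 𝕜 | ∀ i, ‖y i - x i‖₊ < ρ x} := by
    intro x hx
    refine Set.mem_iUnion₂.2 ⟨x, hx, fun i => ?_⟩
    simpa using hρ x hx
  obtain ⟨s, hsK, hsfin, hscover⟩ := hK.elim_finite_subcover_image (fun x _ => hopen x) hcover
  refine ⟨hsfin.toFinset, ρ, P, by simpa using hsK, fun x hx => ?_, ?_⟩
  · have hxK : x ∈ K := hsK (hsfin.mem_toFinset.1 hx)
    exact ⟨hρ x hxK, hw x hxK, hev x hxK⟩
  · intro y hy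
    obtain ⟨x, hx, hxy⟩ := Set.mem_iUnion₂.1 (hscover hy)
    exact Set.mem_iUnion₂.2 ⟨x, hsfin.mem_toFinset.2 hx, hxy⟩

/-- **Shrunk covers.** The same with the covering polydiscs shrunk by any factor `c > 0`: finitely
many centres `x ∈ K`, radii `ρₓ > 0` and series `Pₓ` with `‖Pₓ‖_{ρₓ} < ∞` and `f y = Pₓ(y - x)` for
`‖yᵢ - xᵢ‖ ≤ ρₓ`, such that already the polydiscs `{y | ‖yᵢ - xᵢ‖ < c ρₓ}` cover `K` (used with
`c < 1/2` to land in the boxes `2δ < ρ` on which a convergent series is a term of the language of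
`ℝ_an`, `RealAnTerms.lean`). [folklore] -/
theorem exists_finset_cover_eval_eq_of_analyticOnNhd_shrink {f : (ι → 𝕜) → 𝕜} {U K : Set (ι → 𝕜)}
    (hf : AnalyticOnNhd 𝕜 f U) (hK : IsCompact K) (hKU : K ⊆ U) {c : ℝ≥0} (hc : 0 < c) :
    ∃ (s : Finset (ι → 𝕜)) (ρ : (ι → 𝕜) → ℝ≥0) (P : (ι → 𝕜) → MvPowerSeries ι 𝕜),
      (↑s ⊆ K) ∧
      (∀ x ∈ s, 0 < ρ x ∧ wnorm (fun _ : ι => ρ x) (P x) < ⊤ ∧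
        ∀ y : ι → 𝕜, (∀ i, ‖y i - x i‖₊ ≤ ρ x) → eval (P x) (y - x) = f y) ∧
      K ⊆ ⋃ x ∈ s, {y : ι → 𝕜 | ∀ i, ‖y i - x i‖₊ < c * ρ x} := by
  classical
  have hloc : ∀ x ∈ K, ∃ (P : MvPowerSeries ι 𝕜) (ρ : ℝ≥0), 0 < ρ ∧
      wnorm (fun _ : ι => ρ) P < ⊤ ∧
      ∀ y : ι → 𝕜, (∀ i, ‖y i - x i‖₊ ≤ ρ) → eval P (y - x) = f y := by
    intro x hx
    obtain ⟨p, r, hp⟩ := hf x (hKU hx)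
    obtain ⟨P, ρ, hρ, -, hw, hev⟩ := exists_wnorm_lt_top_eval_eq_of_hasFPowerSeriesOnBall hp
    refine ⟨P, ρ, hρ, hw, fun y hy => ?_⟩
    rw [hev (y - x) (by simpa using hy), add_sub_cancel]
  choose! P ρ hρ hw hev using hloc
  have hopen : ∀ x, IsOpen {y : ι → 𝕜 | ∀ i, ‖y i - x i‖₊ < c * ρ x} := by
    intro x
    simp only [Set.setOf_forall]
    exact isOpen_iInter_of_finite fun i =>
      isOpen_lt (continuous_nnnorm.comp ((continuous_apply i).sub continuous_const)) continuous_const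
  have hcover : K ⊆ ⋃ x ∈ K, {y : ι → 𝕜 | ∀ i, ‖y i - x i‖₊ < c * ρ x} := by
    intro x hx
    refine Set.mem_iUnion₂.2 ⟨x, hx, fun i => ?_⟩
    simpa using mul_pos hc (hρ x hx)
  obtain ⟨s, hsK, hsfin, hscover⟩ := hK.elim_finite_subcover_image (fun x _ => hopen x) hcover
  refine ⟨hsfin.toFinset, ρ, P, by simpa using hsK, fun x hx => ?_, ?_⟩
  · have hxK : x ∈ K := hsK (hsfin.mem_toFinset.1 hx)
    exact ⟨hρ x hxK, hw x hxK, hev x hxK⟩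
  · intro y hy
    obtain ⟨x, hx, hxy⟩ := Set.mem_iUnion₂.1 (hscover hy)
    exact Set.mem_iUnion₂.2 ⟨x, hsfin.mem_toFinset.2 hx, hxy⟩

end Complete

end Literature.RingTheory.MvPowerSeries

end
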